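import Summits.QuantumFields.BalabanUV.Beta.EriceRemainderEnclosureHistoryAutonomyComparisonAgeCompositionStaticChainOuterCharges

/-!
# EriceRemainderEnclosureHistoryAutonomyComparisonAgeCompositionStaticChainBudgetMoments — (E75d) MOMENT ENVELOPES OF THE BUDGET SIDE: in (E65a)'s window budget the
# charge `S_{k,j}∕k` of an OLD age `k` on a YOUNGER scale `j` is sandwiched by its first two scaled moments, **`j∕k − ¼(1+1∕j)(j∕k)² ≤ S_{k,j}∕k ≤ j∕k`** — so the
# older usage of a young scale lies between `M₁ − ¼(1+1∕j)M₂` and `M₁ = Ω^u` (`M_p = Σ_k x_k (j∕k)^p`, the same exactly-rescaling moments as (E75c), now of the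
# LOADS) —, and the charge `S_{k,J}∕J` of a YOUNG age `k` on an OLDER scale `J` is above the SEPARABLE form **`2√(k∕J) − (2k+1)∕J`** — so every scale far above
# the current young age constrains all younger loads only through the two aggregates `Σ x_k√k` and `Σ x_k(2k+1)` (the far-past budget aggregation of README
# g66∕e75 §4, numerically loss-free beyond two octaves)

Cell `pub-balaban`, β-function sub-cell, BINDER row D4 «RemainderConst leaves for Bałaban's split» (`HOME/BINDER-OWNERS.md`; owner lineage `b2b-balaban-beta-an4`;
this file by co-owner #2 lineage `b2b-balaban-beta-d4-p2`, generation 66), β-FLOW TEAM duty (1), FREEZE (0) honoured (def-free; imports (E74b)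
`…StaticChainOuterCharges`, uses `readWindow_ge_continuum_sub_one` BY NAME; nothing restated).

HONEST FRAMING (page 1, verbatim and binding).  *"Discharging BetaPertH makes Bałaban's UV stability UNCONDITIONAL — a real constructive-QFT result; it is
NOT the continuum limit and NOT the Clay problem."*  THIS FILE DISCHARGES NOTHING OF THE KIND.  Elementary inequalities about square roots and finite sums —
hypotheses of a census, not facts; the form, signs, ages and moments of Bałaban's (1.22) limit functional are NOT PRINTED ([I] p. 298; GAPS G-t4-U2-1∕-2) and
NOT asserted.  Row D4 class UNCHANGED (critical-path width 0; instance 0∕1; D4 DISCHARGE NO DATE).  HONEST DEPENDENCY: continuum YM on T⁴ ⇐ BetaPertH ∧ nine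
spine estimates (0/9 proved); BetaPertH ⇐ (D1) ∧ (D4) ∧ CAP+tail; G-an2-4 gates asym, D1 and NE2/3/4.

THE POINT (README `HOME/b2b-balaban-beta-d4-p2/g66/e75/README.md` §3–§4).  (E75c) shows that the COMPOUNDING side of the window-mass chain is carried by the
scaled moments of the carried ratios.  The BUDGET side has the same structure in the direction old → young: the read window `S_{k,j} = Σ_{l<j} √(k∕(k+l+1))`
of an old age `k ≥ j` has `1 − (l+1)∕(2k) ≤ √(k∕(k+l+1)) ≤ 1`, so `S_{k,j}∕k` is its first scaled moment `j∕k` minus at most a quarter of the second (plus the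
lattice term `(j∕k)²∕(4j)`): the older usage of the young scale's budget is a two-moment quantity up to `O((j∕k)³)`, with the SAME exact rescaling and update as
(E75c)'s moments.  In the direction young → old the charge is NOT polynomial in `k∕J` (it is `≈ 2√(k∕J)`), but it is bounded BELOW by the separable
`2√(k∕J) − (2k+1)∕J` ((E74b)'s continuum window minus one), which is what lets a majorant chain replace all budget lines more than `Λ₀` octaves above the
current young age by ONE aggregate constraint on `Σ x_k √k` (and `Σ x_k (2k+1)`); numerics of record (`g66/numerics/far1.py`, kit j313321): loss-free for
`Λ₀ ≥ 4`, fatal at `Λ₀ = 2`.  NOT CLAIMED: any certificate; the static closure; anything printed.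

WHAT IS PROVED ([folklore]; 0 `def`, 0 sorry).  §1 OLD ON YOUNG: `one_sub_half_le_sqrt` (`1 − a∕2 ≤ √(1∕(1+a))`, `a ≥ 0`), `summand_ge_linear`, **`readWindow_ge_two_moment`**
(`j − j(j+1)∕(4k) ≤ S_{k,j}`), `readWindow_le_card` (`S_{k,j} ≤ j`), **`old_charge_two_moment`** (`j∕k − ¼(1+1∕j)(j∕k)² ≤ S_{k,j}∕k ≤ j∕k`), **`old_usage_two_moment`**
(summed over old ages with loads `x ≥ 0`: `M₁ − ¼(1+1∕j)M₂ ≤ U_old ≤ M₁`).  §2 YOUNG ON OLD: **`young_charge_ge_separable`** (`2√(k∕J) − (2k+1)∕J ≤ S_{k,J}∕J`),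
**`young_usage_ge_separable`** (summed: `2J^{−1∕2}·Σ x_k√k − J^{−1}·Σ x_k(2k+1) ≤ U_young`).  §3 (append) `chord_le_sqrt_one_add`,
**`young_charge_ge_three_term`** (`2√σ − 2σ + 2(√2−1)σ^{3∕2} − 1∕J ≤ S_{k,J}∕J`, exact continuum part at `σ = 0, 1`).
-/
noncomputable section
open Finset

namespace Summit.QuantumFields.BalabanUV.Beta.EriceRemainderEnclosureHistoryAutonomyComparisonAgeCompositionStaticChainBudgetMoments

open Summit.QuantumFields.BalabanUV.Beta.EriceRemainderEnclosureHistoryAutonomyComparisonAgeCompositionStaticChainOuterCharges (readWindow_ge_continuum_sub_one)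

/-! ## §1 Old on young: the charge is a two-moment quantity -/

/-- `1 − a∕2 ≤ √(1∕(1+a))` for `a ≥ 0` (convexity of `(1+a)^{−1∕2}`; trivial when `a ≥ 2`). [folklore] -/
theorem one_sub_half_le_sqrt {a : ℝ} (ha : 0 ≤ a) : 1 - a / 2 ≤ Real.sqrt (1 / (1 + a)) := by
  by_cases h : 1 - a / 2 ≤ 0
  · exact h.trans (Real.sqrt_nonneg _)
  · apply Real.le_sqrt_of_sq_le
    rw [le_div_iff₀ (by linarith)]
    nlinarith [sq_nonneg a, mul_nonneg ha (sq_nonneg a)]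

/-- Each read-window summand of an old age `k > 0` is at least linear in the lag: `1 − (l+1)∕(2k) ≤ √(k∕(k+l+1))`. [folklore] -/
theorem summand_ge_linear {k : ℝ} (hk : 0 < k) (l : ℕ) : 1 - ((l : ℝ) + 1) / (2 * k) ≤ Real.sqrt (k / (k + l + 1)) := by
  have h := one_sub_half_le_sqrt (a := ((l : ℝ) + 1) / k) (by positivity)
  have e1 : 1 / (1 + ((l : ℝ) + 1) / k) = k / (k + l + 1) := by
    field_simp
    ring
  have e2 : ((l : ℝ) + 1) / k / 2 = ((l : ℝ) + 1) / (2 * k) := by ring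
  rw [e1, e2] at h
  exact h

/-- **THE READ WINDOW IS AT LEAST ITS TWO-MOMENT FORM**: `j − j(j+1)∕(4k) ≤ S_{k,j} = Σ_{l<j} √(k∕(k+l+1))` for `k > 0`. [folklore] -/
theorem readWindow_ge_two_moment {k : ℝ} (hk : 0 < k) (j : ℕ) :
    (j : ℝ) - (j : ℝ) * ((j : ℝ) + 1) / (4 * k) ≤ ∑ l ∈ range j, Real.sqrt (k / (k + l + 1)) := by
  have hsum : ∑ l ∈ range j, (1 - ((l : ℝ) + 1) / (2 * k)) = (j : ℝ) - (j : ℝ) * ((j : ℝ) + 1) / (4 * k) := by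
    induction j with
    | zero => simp
    | succ n ih =>
      rw [sum_range_succ, ih]
      push_cast
      field_simp
      ring
  rw [← hsum]
  exact sum_le_sum fun l _ => summand_ge_linear hk l

/-- The read window has at most `j` terms each `≤ 1`: `S_{k,j} ≤ j` (`k > 0`). [folklore] -/
theorem readWindow_le_card {k : ℝ} (hk : 0 < k) (j : ℕ) : ∑ l ∈ range j, Real.sqrt (k / (k + l + 1)) ≤ j := by
  have hterm : ∀ l ∈ range j, Real.sqrt (k / (k + l + 1)) ≤ 1 := fun l _ => by
    rw [Real.sqrt_le_one]
    have : (0 : ℝ) ≤ l := Nat.cast_nonneg l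
    rw [div_le_one (by positivity)]
    linarith
  calc ∑ l ∈ range j, Real.sqrt (k / (k + l + 1)) ≤ ∑ _l ∈ range j, (1 : ℝ) := sum_le_sum hterm
    _ = j := by simp

/-- **THE OLD-ON-YOUNG CHARGE IS SANDWICHED BY TWO SCALED MOMENTS**: for an old age `k > 0` and a young scale `j ≥ 1`,
`j∕k − ¼(1 + 1∕j)(j∕k)² ≤ S_{k,j}∕k ≤ j∕k` (the lattice term `(j∕k)²∕(4j)` included; the continuum coefficient of `(j∕k)²` is exactly `−¼`). [folklore] -/
theorem old_charge_two_moment {k : ℝ} (hk : 0 < k) {j : ℕ} (hj : 1 ≤ j) :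
    (j : ℝ) / k - 1 / 4 * (1 + 1 / (j : ℝ)) * ((j : ℝ) / k) ^ 2 ≤ (∑ l ∈ range j, Real.sqrt (k / (k + l + 1))) / k ∧
      (∑ l ∈ range j, Real.sqrt (k / (k + l + 1))) / k ≤ (j : ℝ) / k := by
  have hjr : (0 : ℝ) < j := by exact_mod_cast hj
  constructor
  · have h := readWindow_ge_two_moment hk j
    have e : (j : ℝ) / k - 1 / 4 * (1 + 1 / (j : ℝ)) * ((j : ℝ) / k) ^ 2 = ((j : ℝ) - (j : ℝ) * ((j : ℝ) + 1) / (4 * k)) / k := by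
      field_simp
    rw [e]
    exact div_le_div_of_nonneg_right h hk.le
  · exact div_le_div_of_nonneg_right (readWindow_le_card hk j) hk.le

/-- **THE OLDER USAGE OF A YOUNG SCALE IS A TWO-MOMENT QUANTITY.**  Old ages `a_i > 0` (`i ∈ I`) with loads `x_i ≥ 0`, young scale `j ≥ 1`: with
`M_p = Σ_i x_i (j∕a_i)^p` (the exactly-rescaling load moments), `M₁ − ¼(1+1∕j)·M₂ ≤ Σ_i x_i·S_{a_i,j}∕a_i ≤ M₁` — the window-mass chain's `Ω^u` IS `M₁`, and the
budget usage it must leave to the young load differs from `Ω^u` by at most a quarter of the second moment. [folklore] -/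
theorem old_usage_two_moment {ι : Type*} (I : Finset ι) {a x : ι → ℝ} (ha : ∀ i ∈ I, 0 < a i) (hx : ∀ i ∈ I, 0 ≤ x i) {j : ℕ} (hj : 1 ≤ j) :
    ∑ i ∈ I, x i * ((j : ℝ) / a i) - 1 / 4 * (1 + 1 / (j : ℝ)) * ∑ i ∈ I, x i * ((j : ℝ) / a i) ^ 2 ≤
      ∑ i ∈ I, x i * ((∑ l ∈ range j, Real.sqrt (a i / (a i + l + 1))) / a i) ∧
    ∑ i ∈ I, x i * ((∑ l ∈ range j, Real.sqrt (a i / (a i + l + 1))) / a i) ≤ ∑ i ∈ I, x i * ((j : ℝ) / a i) := by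
  constructor
  · rw [mul_sum, ← sum_sub_distrib]
    refine sum_le_sum fun i hi => ?_
    have h := (old_charge_two_moment (ha i hi) hj).1
    have := mul_le_mul_of_nonneg_left h (hx i hi)
    linarith [this]
  · exact sum_le_sum fun i hi => mul_le_mul_of_nonneg_left (old_charge_two_moment (ha i hi) hj).2 (hx i hi)

/-! ## §2 Young on old: the charge is above a separable form -/

/-- **THE YOUNG-ON-OLD CHARGE IS ABOVE A SEPARABLE FORM**: a young age `k > 0` is charged on an older scale `J ≥ 1` at least
`2√(k∕J) − (2k+1)∕J ≤ S_{k,J}∕J` — (E74b)'s `2k(√(1+J∕k) − 1) − 1 ≤ S_{k,J}` with `2k√(1+J∕k) = 2√(k² + kJ) ≥ 2√(kJ)`.  As a function of the old scale this is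
`J^{−1∕2}·2√k − J^{−1}·(2k+1)`: all scales above aggregate. [folklore] -/
theorem young_charge_ge_separable {k : ℝ} (hk : 0 < k) {J : ℕ} (hJ : 1 ≤ J) :
    2 * Real.sqrt (k / J) - (2 * k + 1) / J ≤ (∑ l ∈ range J, Real.sqrt (k / (k + l + 1))) / J := by
  have hJr : (0 : ℝ) < J := by exact_mod_cast hJ
  have h := (readWindow_ge_continuum_sub_one hk J).1
  -- 2k√(1+J/k) ≥ 2√(kJ)
  have hs : Real.sqrt (k * J) ≤ k * Real.sqrt (1 + J / k) := by
    rw [show k * Real.sqrt (1 + J / k) = Real.sqrt (k ^ 2 * (1 + J / k)) by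
      rw [Real.sqrt_mul (sq_nonneg k), Real.sqrt_sq hk.le]]
    apply Real.sqrt_le_sqrt
    have : k ^ 2 * (1 + J / k) = k * J + k ^ 2 := by field_simp; ring
    rw [this]; nlinarith
  have hkJ : Real.sqrt (k / J) = Real.sqrt (k * J) / J := by
    rw [show k / (J : ℝ) = k * J / (J : ℝ) ^ 2 by field_simp, Real.sqrt_div' _ (sq_nonneg _), Real.sqrt_sq hJr.le]
  rw [hkJ, le_div_iff₀ hJr]
  have e : (2 * (Real.sqrt (k * J) / J) - (2 * k + 1) / J) * J = 2 * Real.sqrt (k * J) - (2 * k + 1) := by field_simp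
  rw [e]
  linarith

/-- **THE YOUNGER USAGE OF AN OLD SCALE IS ABOVE TWO AGGREGATES.**  Younger ages `a_i > 0` (`i ∈ I`) with loads `x_i ≥ 0`, old scale `J ≥ 1`:
`2J^{−1∕2}·Σ_i x_i√a_i − J^{−1}·Σ_i x_i(2a_i+1) ≤ Σ_i x_i·S_{a_i,J}∕J` — every budget line above the current young age binds the future loads only through
`Σ x√a` and `Σ x(2a+1)` once this (valid, outer) relaxation is accepted; numerics (kit j313321): no measurable loss when applied to scales `≥ 4×` the load's
age, a large loss at `2×`. [folklore] -/
theorem young_usage_ge_separable {ι : Type*} (I : Finset ι) {a x : ι → ℝ} (ha : ∀ i ∈ I, 0 < a i) (hx : ∀ i ∈ I, 0 ≤ x i) {J : ℕ} (hJ : 1 ≤ J) :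
    2 / Real.sqrt J * ∑ i ∈ I, x i * Real.sqrt (a i) - 1 / J * ∑ i ∈ I, x i * (2 * a i + 1) ≤
      ∑ i ∈ I, x i * ((∑ l ∈ range J, Real.sqrt (a i / (a i + l + 1))) / J) := by
  have hJr : (0 : ℝ) < J := by exact_mod_cast hJ
  rw [mul_sum, mul_sum, ← sum_sub_distrib]
  refine sum_le_sum fun i hi => ?_
  have h := mul_le_mul_of_nonneg_left (young_charge_ge_separable (ha i hi) hJ) (hx i hi)
  have e : Real.sqrt (a i / J) = Real.sqrt (a i) / Real.sqrt J := Real.sqrt_div' _ hJr.le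
  rw [e] at h
  have e2 : 2 / Real.sqrt J * (x i * Real.sqrt (a i)) - 1 / J * (x i * (2 * a i + 1)) = x i * (2 * (Real.sqrt (a i) / Real.sqrt J) - (2 * a i + 1) / J) := by
    ring
  rw [e2]
  exact h

/-! ## §3 Young on old: the three-term separable envelope (exact at both ends) -/

/-- `1 + (√2 − 1)σ ≤ √(1+σ)` on `[0,1]` — the chord of the concave `√(1+σ)`. [folklore] -/
theorem chord_le_sqrt_one_add {σ : ℝ} (h0 : 0 ≤ σ) (h1 : σ ≤ 1) : 1 + (Real.sqrt 2 - 1) * σ ≤ Real.sqrt (1 + σ) := by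
  have hs2 : Real.sqrt 2 ^ 2 = 2 := Real.sq_sqrt (by norm_num)
  have hs2' : 1 ≤ Real.sqrt 2 := by
    rw [show (1 : ℝ) = Real.sqrt 1 by simp]; exact Real.sqrt_le_sqrt (by norm_num)
  have hpos : 0 ≤ 1 + (Real.sqrt 2 - 1) * σ := by nlinarith
  apply Real.le_sqrt_of_sq_le
  -- (1 + aσ)² ≤ 1 + σ with a = √2 − 1: 2aσ + a²σ² ≤ σ ⟸ σ ≤ 1 and 2a + a² = 1
  have ha : 2 * (Real.sqrt 2 - 1) + (Real.sqrt 2 - 1) ^ 2 = 1 := by nlinarith [hs2]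
  nlinarith [mul_nonneg h0 (sub_nonneg.mpr h1), sq_nonneg (Real.sqrt 2 - 1), hs2]

/-- **THE THREE-TERM SEPARABLE ENVELOPE OF THE YOUNG-ON-OLD CHARGE**: a young age `k > 0` on an older scale `J ≥ k` (`J ≥ 1`), with `σ = k∕J`:
`2√σ − 2σ + 2(√2−1)σ^{3∕2} − 1∕J ≤ S_{k,J}∕J` — (E74b)'s `J·c(σ) − 1 ≤ S_{k,J}` with `c(σ) = 2√σ·√(1+σ) − 2σ` and the chord `√(1+σ) ≥ 1 + (√2−1)σ`; the
continuum part is EXACT at `σ → 0` and at `σ = 1` (`2 − 2 + 2(√2−1) = c(1)`) and within `3 %` of `c` in between (numerics `g66/numerics/far2.py`), so that every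
older scale binds the younger loads through THREE aggregates `Σ x√k`, `Σ xk`, `Σ xk^{3∕2}`; numerics of record (`far3.py`, kit j313443): applying this
envelope to ALL older scales costs ≤ 8 % in `sup x·V`. [folklore] -/
theorem young_charge_ge_three_term {k : ℝ} (hk : 0 < k) {J : ℕ} (hJ : 1 ≤ J) (hkJ : k ≤ J) :
    2 * Real.sqrt (k / J) - 2 * (k / J) + 2 * (Real.sqrt 2 - 1) * ((k / J) * Real.sqrt (k / J)) - 1 / J ≤
      (∑ l ∈ range J, Real.sqrt (k / (k + l + 1))) / J := by
  have hJr : (0 : ℝ) < J := by exact_mod_cast hJ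
  have h := (readWindow_ge_continuum_sub_one hk J).1
  have hσ0 : 0 ≤ k / J := div_nonneg hk.le hJr.le
  have hσ1 : k / J ≤ 1 := (div_le_one hJr).mpr hkJ
  have hsσ : 0 ≤ Real.sqrt (k / J) := Real.sqrt_nonneg _
  -- √σ·√(1+σ) = σ·√(1 + J/k)
  have e2 : k / J * (1 + k / J) = (k / J) ^ 2 * (1 + J / k) := by field_simp; ring
  have e1 : Real.sqrt (k / J) * Real.sqrt (1 + k / J) = k / J * Real.sqrt (1 + J / k) := by
    rw [← Real.sqrt_mul hσ0, e2, Real.sqrt_mul (sq_nonneg _), Real.sqrt_sq hσ0]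
  have hid : (J : ℝ) * (2 * (Real.sqrt (k / J) * Real.sqrt (1 + k / J)) - 2 * (k / J)) = 2 * k * (Real.sqrt (1 + J / k) - 1) := by
    rw [e1]; field_simp
  have hch := chord_le_sqrt_one_add hσ0 hσ1
  have hmain : 2 * Real.sqrt (k / J) - 2 * (k / J) + 2 * (Real.sqrt 2 - 1) * ((k / J) * Real.sqrt (k / J)) ≤
      2 * (Real.sqrt (k / J) * Real.sqrt (1 + k / J)) - 2 * (k / J) := by
    nlinarith [mul_le_mul_of_nonneg_left hch hsσ]
  rw [le_div_iff₀ hJr]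
  have e3 : (2 * Real.sqrt (k / J) - 2 * (k / J) + 2 * (Real.sqrt 2 - 1) * ((k / J) * Real.sqrt (k / J)) - 1 / J) * J =
      J * (2 * Real.sqrt (k / J) - 2 * (k / J) + 2 * (Real.sqrt 2 - 1) * ((k / J) * Real.sqrt (k / J))) - 1 := by field_simp
  rw [e3]
  calc (J : ℝ) * (2 * Real.sqrt (k / J) - 2 * (k / J) + 2 * (Real.sqrt 2 - 1) * ((k / J) * Real.sqrt (k / J))) - 1
      ≤ J * (2 * (Real.sqrt (k / J) * Real.sqrt (1 + k / J)) - 2 * (k / J)) - 1 := by nlinarith [mul_le_mul_of_nonneg_left hmain hJr.le]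
    _ = 2 * k * (Real.sqrt (1 + J / k) - 1) - 1 := by rw [hid]
    _ ≤ ∑ l ∈ range J, Real.sqrt (k / (k + l + 1)) := h

end Summit.QuantumFields.BalabanUV.Beta.EriceRemainderEnclosureHistoryAutonomyComparisonAgeCompositionStaticChainBudgetMoments

end
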